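import Summits.AtomisticToContinuum.HydrodynamicLimit.Theorems.CollisionIsometryCLTAdaptedWeightCLTBlockHDissipation
import Summits.AtomisticToContinuum.HydrodynamicLimit.Theorems.DiffuseBackwardInfluence.Negative.TransferKernels
import Summits.AtomisticToContinuum.HydrodynamicLimit.Theorems.CollisionIsometryCLTAdaptedWeightCLTTLStubFlowDictionary

/-!
# Stub `stub_contactToMass` (S4) of the line `block-h-dissipation-closure`, helper file 2: the fold/flow
dictionary of idle particles
(crux `CollisionIsometryCLT.AdaptedWeightCLT`, stmt-AtomisticToContinuum-14868; `--supports`, anchor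
`bhContactToMass_dict_anchor`)

H1 (`DiffuseAt`) speaks about the crux's FOLD (the Alexander collision-by-collision construction restarted at the
window start `Φ_{t−Δ} z`): its idle set `DiffuseBackwardInfluenceNeg.idleSet σ N y Δ` collects the particles that
are an endpoint of none of the pairs reflected by the fold steps `k < colls y Δ`. The line's functionals
(`chaosDiss`, `massDiss`) speak about the FLOW: collision times and contact pairs of the orbit `τ ↦ Φ_τ z`
(`HardSphereFlow.collisionPairSum`, `Participates`). This file is the bridge, on the good set:

* `exists_participates_of_not_mem_idleSet`: along a hard-sphere trajectory `γ` in the regular torus geometry, a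
  particle OUTSIDE the fold's idle set of the window `[0, Δ]` (fold started at `γ 0`) participates in a collision
  of `γ` at some time `u ∈ (0, Δ]` — the fold step `k < colls` reflecting it is the `(k+1)`-st collision of the
  trajectory (`IsHardSphereTrajectory.stateAfter_eq_apply`: the algorithm reproduces the collisions), whose
  instant lies in `(0, Δ]` (`FwdGood.exists_segment`, `collisionCount_eq_of_segment`, monotone instants), and the
  reflected pair IS in contact there (`collidePair` keeps positions);
* flow version `exists_participates_flow` (window `(s, s + Δ]` of the orbit of a good datum), the inclusion
  `flowIdleSet ⊆ idleSet` (`flowIdleSet_subset_idleSet`) and the count / fraction comparisons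
  `flowIdleCount ≤ idleCount`, `flowIdleFrac ≤ idleFrac` (`flowIdleFrac_le_idleFrac`): the fraction of particles
  with NO collision of the flow in the window is at most the fold's idle fraction, whose mean H1 kills
  (file `…BHContactToMassIdle`).
-/

namespace Summit.AtomisticToContinuum.HydrodynamicLimit.Theorems.BlockHDissipation

open scoped BigOperators Topology Classical MeasureTheory ENNReal InnerProductSpace
open Filter Set MeasureTheory
open Literature.Analysis.FluidPDE
open Summit.AtomisticToContinuum.HydrodynamicLimit.Theorems.ContactSourceDuhamel (T3 V3 Cfg Vel Flow Flows iprF)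
open Summit.AtomisticToContinuum.HydrodynamicLimit.Theorems.ContactSourceDuhamel.TimeLocal
open Summit.AtomisticToContinuum.HydrodynamicLimit.Theorems.DiffuseBackwardInfluenceNeg (idleFrac idleCount
  idleSet mem_idleSet pairsAt colls)
open Literature.MathematicalPhysics.KineticTheory (hsDiameter hsDiameter_le localGibbsLaw)

noncomputable section

namespace ContactToMass

variable {σ : ℝ} {N : ℕ}

/-! ## The fold's objects against the Alexander construction (all `rfl`) -/

/-- The fold's `colls` is the Alexander collision count. -/
theorem colls_eq (σ : ℝ) (N : ℕ) (y : Cfg N) (Δ : ℝ) :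
    colls σ N y Δ = Alexander.collisionCount (Torus.geometry (Fin 3)) (hsDiameter σ N) y Δ :=
  rfl

/-- The fold's `pairsAt k` is the set of incoming pairs of the line's `pre k`. -/
theorem pairsAt_eq (σ : ℝ) (N : ℕ) (y : Cfg N) (k : ℕ) :
    pairsAt σ N y k = Alexander.incomingPairs (Torus.geometry (Fin 3)) (hsDiameter σ N)
      (ContactSourceDuhamel.pre σ N y k) :=
  rfl

/-- The line's `pre k` is the free flight of the `k`-th Alexander state up to its exit time. -/
theorem pre_eq (σ : ℝ) (N : ℕ) (y : Cfg N) (k : ℕ) :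
    ContactSourceDuhamel.pre σ N y k = freeFlight (Torus.geometry (Fin 3))
      (Alexander.freeExitTime (Torus.geometry (Fin 3)) (hsDiameter σ N)
        (Alexander.stateAfter (Torus.geometry (Fin 3)) (hsDiameter σ N) y k)).toReal
      (Alexander.stateAfter (Torus.geometry (Fin 3)) (hsDiameter σ N) y k) :=
  rfl

/-! ## One fold step is one collision of the trajectory -/

/-- If the `k`-th fold step reflects a pair (`pairsAt k` nonempty), the `k`-th exit time is finite. -/
theorem freeExitTime_ne_top_of_nonempty (hG : (Torus.geometry (Fin 3)).IsHardSphereRegular (hsDiameter σ N))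
    {y : Cfg N} {k : ℕ} (h : (pairsAt σ N y k).Nonempty) :
    Alexander.freeExitTime (Torus.geometry (Fin 3)) (hsDiameter σ N)
      (Alexander.stateAfter (Torus.geometry (Fin 3)) (hsDiameter σ N) y k) ≠ ∞ := by
  intro htop
  have hne := FlowDict.not_nonempty_incomingPairs_of_eq_top hG htop
  rw [pairsAt_eq, FlowDict.pre_of_eq_top y k htop] at h
  exact hne h

/-- If the `k`-th fold step reflects the pair `h.some`, the `(k+1)`-st Alexander state is `collidePair` of that
pair applied to `pre k` (the two `dite`s choose the same pair: proof irrelevance). -/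
theorem stateAfter_succ_eq_collidePair (hG : (Torus.geometry (Fin 3)).IsHardSphereRegular (hsDiameter σ N))
    {y : Cfg N} {k : ℕ} (h : (pairsAt σ N y k).Nonempty) :
    Alexander.stateAfter (Torus.geometry (Fin 3)) (hsDiameter σ N) y (k + 1) =
      collidePair (Torus.geometry (Fin 3)) h.some.1 h.some.2 (ContactSourceDuhamel.pre σ N y k) := by
  have htop := freeExitTime_ne_top_of_nonempty hG h
  rw [Alexander.stateAfter_succ]
  unfold Alexander.collisionStep
  rw [if_neg htop]
  have h' : (Alexander.incomingPairs (Torus.geometry (Fin 3)) (hsDiameter σ N)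
      (freeFlight (Torus.geometry (Fin 3))
        (Alexander.freeExitTime (Torus.geometry (Fin 3)) (hsDiameter σ N)
          (Alexander.stateAfter (Torus.geometry (Fin 3)) (hsDiameter σ N) y k)).toReal
        (Alexander.stateAfter (Torus.geometry (Fin 3)) (hsDiameter σ N) y k))).Nonempty := h
  simp only []
  rw [dif_pos h']
  rfl

/-- The reflected pair of a fold step is in contact in the next Alexander state. -/
theorem mem_contactPairs_stateAfter_succ (hG : (Torus.geometry (Fin 3)).IsHardSphereRegular (hsDiameter σ N))
    {y : Cfg N} {k : ℕ} (h : (pairsAt σ N y k).Nonempty) :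
    (h.some.1, h.some.2) ∈ contactPairs (Torus.geometry (Fin 3)) (hsDiameter σ N)
      (Alexander.stateAfter (Torus.geometry (Fin 3)) (hsDiameter σ N) y (k + 1)) := by
  obtain ⟨hlt, hc, -⟩ := Alexander.mem_incomingPairs.1 h.some_mem
  rw [mem_contactPairs]
  refine ⟨ne_of_lt hlt, ?_⟩
  rw [stateAfter_succ_eq_collidePair hG h]
  exact (mem_contactSet_congr_fst fun j => collidePair_apply_fst _ j).2 hc

/-! ## Along a hard-sphere trajectory: non-idle particles collide in the window -/

/-- For `k < colls y Δ` on a forward-good orbit (`0 ≤ Δ`), the `(k+1)`-st collision instant is at most `Δ`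
(in particular finite). -/
theorem collisionInstant_succ_le_of_lt_colls {y : Cfg N}
    (hgood : Alexander.FwdGood (Torus.geometry (Fin 3)) (hsDiameter σ N) y) {Δ : ℝ} {k : ℕ}
    (hk : k < colls σ N y Δ) :
    Alexander.collisionInstant (Torus.geometry (Fin 3)) (hsDiameter σ N) y (k + 1) ≤ ENNReal.ofReal Δ := by
  obtain ⟨k₀, h1, h2⟩ := hgood.exists_segment Δ
  have hc : colls σ N y Δ = k₀ := by
    rw [colls_eq]
    exact Alexander.collisionCount_eq_of_segment h1 h2
  rw [hc] at hk
  exact (Alexander.monotone_collisionInstant y (Nat.succ_le_of_lt hk)).trans h1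

/-- **A particle outside the fold's idle set collides in the window.** Along a hard-sphere trajectory `γ` of the
regular torus geometry, if `i ∉ idleSet σ N (γ 0) Δ` (`0 ≤ Δ`) then `i` participates in a collision of `γ` at
some time `u ∈ (0, Δ]`. -/
theorem exists_participates_of_not_mem_idleSet
    (hG : (Torus.geometry (Fin 3)).IsHardSphereRegular (hsDiameter σ N)) {γ : ℝ → Cfg N}
    (hγ : IsHardSphereTrajectory (Torus.geometry (Fin 3)) (hsDiameter σ N) (N + 1) γ) {Δ : ℝ} (hΔ : 0 ≤ Δ)
    {i : Fin (N + 1)} (hi : i ∉ idleSet σ N (γ 0) Δ) :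
    ∃ u ∈ Ioc 0 Δ, Participates (Torus.geometry (Fin 3)) (hsDiameter σ N) (γ u) i := by
  rw [mem_idleSet] at hi
  simp only [not_forall] at hi
  obtain ⟨k, hk, h, hih⟩ := hi
  have hgood := hγ.fwdGood_apply_zero hG
  -- the `(k+1)`-st instant is finite, positive and `≤ Δ`
  have hle := collisionInstant_succ_le_of_lt_colls hgood hk
  have hfin : Alexander.collisionInstant (Torus.geometry (Fin 3)) (hsDiameter σ N) (γ 0) (k + 1) ≠ ∞ :=
    ne_top_of_le_ne_top ENNReal.ofReal_ne_top hle
  set T : ℝ := (Alexander.collisionInstant (Torus.geometry (Fin 3)) (hsDiameter σ N) (γ 0) (k + 1)).toReal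
    with hT
  have hTle : T ≤ Δ := ENNReal.toReal_le_of_le_ofReal hΔ hle
  have hTpos : 0 < T := by
    rw [hT]
    refine ENNReal.toReal_pos (ne_of_gt ?_) hfin
    have h1 : Alexander.collisionInstant (Torus.geometry (Fin 3)) (hsDiameter σ N) (γ 0) 1 ≤
        Alexander.collisionInstant (Torus.geometry (Fin 3)) (hsDiameter σ N) (γ 0) (k + 1) :=
      Alexander.monotone_collisionInstant (γ 0) (by omega)
    rw [Alexander.collisionInstant_one] at h1
    exact lt_of_lt_of_le (hγ.freeExitTime_apply_pos hG 0) h1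
  -- the `(k+1)`-st state is `γ T`, and the reflected pair is in contact there
  have hstate := (hγ.stateAfter_eq_apply hG hfin).1
  have hcp := mem_contactPairs_stateAfter_succ hG h
  rw [hstate] at hcp
  refine ⟨T, ⟨hTpos, hTle⟩, ?_⟩
  by_cases hi1 : i = h.some.1
  · rw [hi1]
    exact ⟨h.some.2, Or.inl hcp⟩
  · have hi2 : i = h.some.2 := by
      by_contra hi2
      exact hih ⟨hi1, hi2⟩
    rw [hi2]
    exact ⟨h.some.1, Or.inr hcp⟩

/-! ## Along the flow -/

/-- The particles with NO collision of the flow in the window `(a, b]` of the orbit of `z`. -/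
def flowIdleSet (Φ : Flow σ N) (a b : ℝ) (z : Cfg N) : Set (Fin (N + 1)) :=
  {i | ∀ τ ∈ Ioc a b, ¬ Participates (Torus.geometry (Fin 3)) (hsDiameter σ N) (Φ.flow τ z) i}

/-- Their number. -/
def flowIdleCount (Φ : Flow σ N) (a b : ℝ) (z : Cfg N) : ℕ :=
  Nat.card (flowIdleSet Φ a b z)

/-- Their fraction `#/(N+1) ∈ [0, 1]`. -/
def flowIdleFrac (Φ : Flow σ N) (a b : ℝ) (z : Cfg N) : ℝ :=
  (flowIdleCount Φ a b z : ℝ) / ((N + 1 : ℕ) : ℝ)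

/-- Membership in the flow-idle set, unfolded. -/
theorem mem_flowIdleSet {Φ : Flow σ N} {a b : ℝ} {z : Cfg N} {i : Fin (N + 1)} :
    i ∈ flowIdleSet Φ a b z ↔
      ∀ τ ∈ Ioc a b, ¬ Participates (Torus.geometry (Fin 3)) (hsDiameter σ N) (Φ.flow τ z) i :=
  Iff.rfl

/-- **Flow version.** On the good set, a particle outside the idle set of the fold restarted at `Φ_s z` over
`[0, Δ]` participates in a collision of the orbit at some time `τ ∈ (s, s + Δ]`. -/
theorem exists_participates_flow (hG : (Torus.geometry (Fin 3)).IsHardSphereRegular (hsDiameter σ N))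
    (Φ : Flow σ N) {z : Cfg N} (hz : z ∈ Φ.good) (s : ℝ) {Δ : ℝ} (hΔ : 0 ≤ Δ) {i : Fin (N + 1)}
    (hi : i ∉ idleSet σ N (Φ.flow s z) Δ) :
    ∃ τ ∈ Ioc s (s + Δ), Participates (Torus.geometry (Fin 3)) (hsDiameter σ N) (Φ.flow τ z) i := by
  set γ : ℝ → Cfg N := fun u => Φ.flow (u + s) z with hγdef
  have hγ : IsHardSphereTrajectory (Torus.geometry (Fin 3)) (hsDiameter σ N) (N + 1) γ :=
    (Φ.isTrajectory z hz).comp_add_right s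
  have h0 : γ 0 = Φ.flow s z := by
    simp only [hγdef, zero_add]
  rw [← h0] at hi
  obtain ⟨u, hu, hp⟩ := exists_participates_of_not_mem_idleSet hG hγ hΔ hi
  exact ⟨u + s, ⟨by linarith [hu.1], by linarith [hu.2]⟩, hp⟩

/-- **The dictionary.** On the good set the flow-idle set of the window `(s, s + Δ]` is contained in the idle set
of the fold restarted at `Φ_s z`. -/
theorem flowIdleSet_subset_idleSet (hG : (Torus.geometry (Fin 3)).IsHardSphereRegular (hsDiameter σ N))
    (Φ : Flow σ N) {z : Cfg N} (hz : z ∈ Φ.good) (s : ℝ) {Δ : ℝ} (hΔ : 0 ≤ Δ) :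
    flowIdleSet Φ s (s + Δ) z ⊆ idleSet σ N (Φ.flow s z) Δ := by
  intro i hi
  by_contra hni
  obtain ⟨τ, hτ, hp⟩ := exists_participates_flow hG Φ hz s hΔ hni
  exact (mem_flowIdleSet.1 hi) τ hτ hp

/-- Counts: `flowIdleCount ≤ idleCount` on the good set. -/
theorem flowIdleCount_le_idleCount (hG : (Torus.geometry (Fin 3)).IsHardSphereRegular (hsDiameter σ N))
    (Φ : Flow σ N) {z : Cfg N} (hz : z ∈ Φ.good) (s : ℝ) {Δ : ℝ} (hΔ : 0 ≤ Δ) :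
    flowIdleCount Φ s (s + Δ) z ≤ idleCount σ N (Φ.flow s z) Δ := by
  unfold flowIdleCount idleCount
  exact Nat.card_mono (Set.toFinite _) (flowIdleSet_subset_idleSet hG Φ hz s hΔ)

/-- Fractions: `flowIdleFrac ≤ idleFrac` on the good set. -/
theorem flowIdleFrac_le_idleFrac (hG : (Torus.geometry (Fin 3)).IsHardSphereRegular (hsDiameter σ N))
    (Φ : Flow σ N) {z : Cfg N} (hz : z ∈ Φ.good) (s : ℝ) {Δ : ℝ} (hΔ : 0 ≤ Δ) :
    flowIdleFrac Φ s (s + Δ) z ≤ idleFrac σ N (Φ.flow s z) Δ := by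
  unfold flowIdleFrac idleFrac
  have hN : (0 : ℝ) < ((N + 1 : ℕ) : ℝ) := by positivity
  exact div_le_div_of_nonneg_right (by exact_mod_cast flowIdleCount_le_idleCount hG Φ hz s hΔ) hN.le

/-- The flow-idle fraction is nonnegative. -/
theorem flowIdleFrac_nonneg (Φ : Flow σ N) (a b : ℝ) (z : Cfg N) : 0 ≤ flowIdleFrac Φ a b z := by
  unfold flowIdleFrac
  positivity

/-- The flow-idle fraction is at most `1`. -/
theorem flowIdleFrac_le_one (Φ : Flow σ N) (a b : ℝ) (z : Cfg N) : flowIdleFrac Φ a b z ≤ 1 := by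
  unfold flowIdleFrac flowIdleCount
  have hN : (0 : ℝ) < ((N + 1 : ℕ) : ℝ) := by positivity
  rw [div_le_one hN]
  have h : Nat.card (flowIdleSet Φ a b z) ≤ N + 1 := by
    have h1 := Nat.card_le_card_of_injective (Subtype.val : flowIdleSet Φ a b z → Fin (N + 1))
      Subtype.val_injective
    simpa only [Nat.card_eq_fintype_card, Fintype.card_fin] using h1
  exact_mod_cast h

/-- The window form used with H1: for the window `(t − Δ, t]` (`0 ≤ Δ`) of a good orbit,
`flowIdleFrac ≤ idleFrac σ N (Φ_{t−Δ} z) Δ`. -/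
theorem flowIdleFrac_window_le (hG : (Torus.geometry (Fin 3)).IsHardSphereRegular (hsDiameter σ N))
    (Φ : Flow σ N) {z : Cfg N} (hz : z ∈ Φ.good) (t : ℝ) {Δ : ℝ} (hΔ : 0 ≤ Δ) :
    flowIdleFrac Φ (t - Δ) t z ≤ idleFrac σ N (Φ.flow (t - Δ) z) Δ := by
  have h := flowIdleFrac_le_idleFrac hG Φ hz (t - Δ) hΔ
  rwa [sub_add_cancel] at h

/-- Up to the null set `goodᶜ`, the event `{ε < flowIdleFrac}` of the window `(t − Δ, t]` is contained in the
fold event `{ε < idleFrac σ N (Φ_{t−Δ} z) Δ}`; hence the comparison of probabilities for any measure that does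
not charge `goodᶜ`. -/
theorem measure_flowIdleFrac_gt_le (hG : (Torus.geometry (Fin 3)).IsHardSphereRegular (hsDiameter σ N))
    (Φ : Flow σ N) (P : Measure (Cfg N)) (hgood : P Φ.goodᶜ = 0) (ε t : ℝ) {Δ : ℝ} (hΔ : 0 ≤ Δ) :
    P {z | ε < flowIdleFrac Φ (t - Δ) t z} ≤ P {z | ε < idleFrac σ N (Φ.flow (t - Δ) z) Δ} := by
  have hsub : {z | ε < flowIdleFrac Φ (t - Δ) t z} ⊆
      {z | ε < idleFrac σ N (Φ.flow (t - Δ) z) Δ} ∪ Φ.goodᶜ := by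
    intro z hz
    by_cases hg : z ∈ Φ.good
    · exact Or.inl (lt_of_lt_of_le hz (flowIdleFrac_window_le hG Φ hg t hΔ))
    · exact Or.inr hg
  calc P {z | ε < flowIdleFrac Φ (t - Δ) t z}
      ≤ P ({z | ε < idleFrac σ N (Φ.flow (t - Δ) z) Δ} ∪ Φ.goodᶜ) := measure_mono hsub
    _ ≤ P {z | ε < idleFrac σ N (Φ.flow (t - Δ) z) Δ} + P Φ.goodᶜ := measure_union_le _ _
    _ = _ := by rw [hgood, add_zero]

/-- Means: `E[flowIdleFrac] ≤ E[idleFrac σ N (Φ_{t−Δ} ·) Δ]` for any measure that does not charge `goodᶜ`. -/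
theorem lintegral_flowIdleFrac_le (hG : (Torus.geometry (Fin 3)).IsHardSphereRegular (hsDiameter σ N))
    (Φ : Flow σ N) (P : Measure (Cfg N)) (hgood : P Φ.goodᶜ = 0) (t : ℝ) {Δ : ℝ} (hΔ : 0 ≤ Δ) :
    ∫⁻ z, ENNReal.ofReal (flowIdleFrac Φ (t - Δ) t z) ∂P ≤
      ∫⁻ z, ENNReal.ofReal (idleFrac σ N (Φ.flow (t - Δ) z) Δ) ∂P := by
  refine lintegral_mono_ae ?_
  have hae : ∀ᵐ z ∂P, z ∈ Φ.good := by
    rw [ae_iff]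
    exact hgood
  filter_upwards [hae] with z hz
  exact ENNReal.ofReal_le_ofReal (flowIdleFrac_window_le hG Φ hz t hΔ)

end ContactToMass

/-- Registration anchor of this helper file (`--supports stmt-AtomisticToContinuum-14868`, stub
`stub_contactToMass`, file 2): on the good set of a hard-sphere flow at `0 < σ < 1/2`, a particle outside the idle
set of the crux's fold restarted at `Φ_s z` over `[0, Δ]` participates in a collision of the orbit in
`(s, s + Δ]` — the `∀`-closed form of `ContactToMass.exists_participates_flow`. -/
theorem bhContactToMass_dict_anchor : ∀ (σ : ℝ) (N : ℕ), 0 < σ → σ < 2⁻¹ → ∀ (Φ : Flow σ N) (z : Cfg N),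
    z ∈ Φ.good → ∀ (s Δ : ℝ), 0 ≤ Δ → ∀ i : Fin (N + 1),
      i ∉ DiffuseBackwardInfluenceNeg.idleSet σ N (Φ.flow s z) Δ →
        ∃ τ ∈ Ioc s (s + Δ), Participates (Torus.geometry (Fin 3)) (hsDiameter σ N) (Φ.flow τ z) i :=
  fun _ N hσ hσ2 Φ _ hz s _ hΔ _ hi =>
    ContactToMass.exists_participates_flow (FlowDict.regular_hsDiameter hσ.le hσ2 N) Φ hz s hΔ hi

end

end Summit.AtomisticToContinuum.HydrodynamicLimit.Theorems.BlockHDissipation
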